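import Summits.ResolutionOfSingularities.ResolutionOfSingularities.Theses.RuledResidues
import Literature.AlgebraicGeometry.Resolution.RegularLocalRingsNormal

/-!
# `NonRuledCofinite` (crux `stmt-ResolutionOfSingularities-18076`), line `regular-atlas`:
# stub 3 (`stub_exceptionalPrimesFinite`) needs its height-one clause — the cusp × line

Negative lemma for the registered line `Cruxes/NonRuledCofinite/Lines/regular_atlas.lean` of the
crux `NonRuledCofinite` (route `ResolutionOfSingularities/RuledResidues`; cdisprove seat,
`--supports stmt-ResolutionOfSingularities-18076`; work file `Cruxes/NonRuledCofinite/Disproof.lean`).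

Stub 3 of the line says: for finitely generated `k`-subalgebras `R ≤ B` of `K = Frac R`, the primes
`𝔭` of `B` OF HEIGHT ONE at which `B_𝔭` is regular but `R_{𝔭 ∩ R}` is not are finitely many (true:
they are minimal over a common denominator).  This file shows the clause `ht 𝔭 = 1` is
LOAD-BEARING: with it deleted the statement is FALSE at the cusp × line
`R = k[t², t³, y] ≤ B = k[t, y] ⊆ K = k(t, y)` over an infinite field — every maximal ideal
`(t, y - c)` of the regular chart `B` contracts to a point of the singular line `t = 0` of `Spec R`,
whose local ring is not regular (not integrally closed: `t² ∈ R`, `t ∉ R_𝔮` because every element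
of `R` has vanishing `t¹`-coefficient while a denominator off `(t, y - c)` has `s(0, c) ≠ 0`).

* `not_isRegularLocalRing_localization_of_pow_mem` — the general non-normality test used here and
  by `CuspExceptionalSet.lean`: `tⁿ ∈ R₀`, `t ∉ (R₀)_𝔮` ⇒ `(R₀)_𝔮` not regular
  (regular ⇒ integrally closed, Matsumura Thm. 19.4 = `isIntegrallyClosed_of_isRegularLocalRing`).
* `stub_exceptionalPrimesFinite_false_without_heightOne` — the mutated stub, refuted at
  `k = 𝔽₂^alg`, `K = Frac k[y][t]`.

References: Matsumura, *Commutative Ring Theory*, Thm. 19.4, Thm. 19.5 (polynomial rings over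
regular rings are regular — Mathlib `Polynomial.isRegularRing_of_isRegularRing`); Hartshorne,
*Algebraic Geometry*, I Ex. 5.6 (the cuspidal cubic).
-/

noncomputable section

set_option linter.dupNamespace false

open Polynomial
open Literature.AlgebraicGeometry.Resolution

namespace Summit.ResolutionOfSingularities.ResolutionOfSingularities.Theorems.NonRuledCofinite.Negative

/-! ## Regular local rings are normal: a non-normality test -/

/-- **Non-normality test for non-regularity**: if `t ∈ K = Frac R₀` has `tⁿ ∈ R₀` (`n > 0`) but
`t · s ≠ a` for all `a ∈ R₀`, `s ∈ R₀ ∖ 𝔮` (i.e. `t ∉ (R₀)_𝔮`), then `(R₀)_𝔮` is not a regular local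
ring — a regular local ring is integrally closed (`isIntegrallyClosed_of_isRegularLocalRing`).
[folklore] -/
theorem not_isRegularLocalRing_localization_of_pow_mem {R₀ K : Type*} [CommRing R₀] [IsDomain R₀]
    [Field K] [Algebra R₀ K] [IsFractionRing R₀ K] (𝔮 : Ideal R₀) [𝔮.IsPrime] (t : K) {n : ℕ}
    (hn : 0 < n) (htn : ∃ r : R₀, algebraMap R₀ K r = t ^ n)
    (hne : ∀ a s : R₀, s ∉ 𝔮 → t * algebraMap R₀ K s ≠ algebraMap R₀ K a) :
    ¬ IsRegularLocalRing (Localization.AtPrime 𝔮) := by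
  intro hreg
  have hunits : ∀ y : 𝔮.primeCompl, IsUnit (algebraMap R₀ K y) := by
    intro y
    refine isUnit_iff_ne_zero.mpr ?_
    rw [Ne, FaithfulSMul.algebraMap_eq_zero_iff]
    rintro h0
    exact y.2 (h0 ▸ 𝔮.zero_mem)
  letI : Algebra (Localization.AtPrime 𝔮) K :=
    (IsLocalization.lift (M := 𝔮.primeCompl) hunits).toAlgebra
  haveI : IsScalarTower R₀ (Localization.AtPrime 𝔮) K :=
    IsScalarTower.of_algebraMap_eq fun x => by
      rw [RingHom.algebraMap_toAlgebra]
      exact (IsLocalization.lift_eq hunits x).symm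
  haveI : IsFractionRing (Localization.AtPrime 𝔮) K :=
    IsFractionRing.isFractionRing_of_isDomain_of_isLocalization 𝔮.primeCompl
      (Localization.AtPrime 𝔮) K
  haveI : IsIntegrallyClosed (Localization.AtPrime 𝔮) :=
    isIntegrallyClosed_of_isRegularLocalRing (Localization.AtPrime 𝔮)
  have htn' : IsIntegral (Localization.AtPrime 𝔮) (t ^ n) := by
    obtain ⟨r, hr⟩ := htn
    rw [← hr, IsScalarTower.algebraMap_apply R₀ (Localization.AtPrime 𝔮) K]
    exact isIntegral_algebraMap
  obtain ⟨y, hy⟩ := IsIntegrallyClosed.exists_algebraMap_eq_of_isIntegral_pow hn htn'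
  obtain ⟨⟨a, s⟩, rfl⟩ := IsLocalization.mk'_surjective 𝔮.primeCompl y
  have e := congrArg (algebraMap (Localization.AtPrime 𝔮) K)
    (IsLocalization.mk'_spec (Localization.AtPrime 𝔮) a s)
  rw [map_mul, hy, ← IsScalarTower.algebraMap_apply, ← IsScalarTower.algebraMap_apply] at e
  exact hne a s s.2 e

/-! ## The cusp × line `k[t², t³, y] ≤ k[t, y] ⊆ k(t, y)` -/

section CuspTimesLine

variable (k : Type) [Field k]

/-- `k(t, y)` realised as the fraction field of `k[y][t]` (outer variable `t`, inner `y`). [folklore] -/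
abbrev K₂ : Type := FractionRing k[X][X]

/-- `t ∈ k(t, y)`. [folklore] -/
abbrev tK : K₂ k := algebraMap k[X][X] (K₂ k) X

/-- `y ∈ k(t, y)`. [folklore] -/
abbrev yK : K₂ k := algebraMap k[X][X] (K₂ k) (C X)

/-- The canonical `k`-algebra map `k[y][t] → k(t, y)`. [folklore] -/
abbrev toK₂ : k[X][X] →ₐ[k] K₂ k := IsScalarTower.toAlgHom k k[X][X] (K₂ k)

/-- `k[y][t] → k(t, y)` is injective. [folklore] -/
theorem toK₂_injective : Function.Injective (toK₂ k) := IsFractionRing.injective k[X][X] (K₂ k)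

/-- The regular chart `B = k[t, y] ⊆ k(t, y)`. [folklore] -/
def planeModel : Subalgebra k (K₂ k) := (toK₂ k).range

/-- `k[t, y] ≅ k[y][t]`. [folklore] -/
def planeModelEquiv : k[X][X] ≃ₐ[k] planeModel k := AlgEquiv.ofInjective (toK₂ k) (toK₂_injective k)

/-- The chart isomorphism is the canonical map on underlying elements. [folklore] -/
theorem coe_planeModelEquiv (P : k[X][X]) :
    ((planeModelEquiv k P : planeModel k) : K₂ k) = algebraMap k[X][X] (K₂ k) P := rfl

/-- The inverse chart isomorphism recovers the polynomial. [folklore] -/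
theorem planeModelEquiv_symm_apply (P : k[X][X]) (h : algebraMap k[X][X] (K₂ k) P ∈ planeModel k) :
    (planeModelEquiv k).symm ⟨algebraMap k[X][X] (K₂ k) P, h⟩ = P := by
  apply (planeModelEquiv k).injective
  rw [AlgEquiv.apply_symm_apply]
  exact Subtype.ext (coe_planeModelEquiv k P).symm

/-- Membership in the chart: images of polynomials. [folklore] -/
theorem mem_planeModel_iff {x : K₂ k} : x ∈ planeModel k ↔ ∃ P : k[X][X], algebraMap k[X][X] (K₂ k) P = x := by
  simp [planeModel, AlgHom.mem_range]

/-- `k[t, y]` is finitely generated. [folklore] -/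
theorem planeModel_fg : (planeModel k).FG := by
  have h : (⊤ : Subalgebra k k[X][X]).FG := Algebra.FiniteType.out
  have := h.map (toK₂ k)
  rwa [Algebra.map_top] at this

/-- `k[t, y]` is a regular ring (polynomial rings over a field). [folklore] -/
instance isRegularRing_planeModel : IsRegularRing (planeModel k) :=
  IsRegularRing.of_ringEquiv (planeModelEquiv k).toRingEquiv

/-- The cusp × line `R = k[t², t³, y]`. [folklore] -/
def cuspLineModel : Subalgebra k (K₂ k) := Algebra.adjoin k {tK k ^ 2, tK k ^ 3, yK k}

/-- `k[t², t³, y]` is finitely generated. [folklore] -/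
theorem cuspLineModel_fg : (cuspLineModel k).FG :=
  Subalgebra.fg_def.mpr ⟨_, ((Set.finite_singleton _).insert _).insert _, rfl⟩

/-- `k[t², t³, y] ⊆ k[t, y]`. [folklore] -/
theorem cuspLineModel_le_planeModel : cuspLineModel k ≤ planeModel k := by
  refine Algebra.adjoin_le ?_
  rintro _ (rfl | rfl | rfl)
  · exact ⟨X ^ 2, by simp⟩
  · exact ⟨X ^ 3, by simp⟩
  · exact ⟨C X, rfl⟩

/-- `tᵐ ∈ k[t², t³, y]` for `m ≥ 2`. [folklore] -/
theorem pow_mem_cuspLineModel {m : ℕ} (hm : 2 ≤ m) : tK k ^ m ∈ cuspLineModel k := by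
  induction m using Nat.strong_induction_on with
  | _ m ih =>
    rcases Nat.lt_or_ge m 4 with h4 | h4
    · interval_cases m
      · exact Algebra.subset_adjoin (by simp)
      · exact Algebra.subset_adjoin (by simp)
    · have : tK k ^ m = tK k ^ 2 * tK k ^ (m - 2) := by
        rw [← pow_add]; congr 1; omega
      rw [this]
      exact Subalgebra.mul_mem _ (Algebra.subset_adjoin (by simp))
        (ih (m - 2) (by omega) (by omega))

/-- `k[y] ⊆ k[t², t³, y]`. [folklore] -/
theorem algebraMap_C_mem_cuspLineModel (a : k[X]) :
    algebraMap k[X][X] (K₂ k) (C a) ∈ cuspLineModel k := by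
  induction a using Polynomial.induction_on' with
  | add p q hp hq =>
    rw [map_add, map_add]
    exact Subalgebra.add_mem _ hp hq
  | monomial n c =>
    rw [← C_mul_X_pow_eq_monomial, map_mul, map_pow, map_mul, map_pow]
    refine Subalgebra.mul_mem _ ?_ (Subalgebra.pow_mem _ (Algebra.subset_adjoin (by simp)) n)
    have : (C (C c) : k[X][X]) = algebraMap k k[X][X] c := by
      rw [Polynomial.algebraMap_apply, Polynomial.algebraMap_eq]
    rw [this, ← IsScalarTower.algebraMap_apply]
    exact Subalgebra.algebraMap_mem _ c

/-- `t² · k[t, y] ⊆ k[t², t³, y]`. [folklore] -/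
theorem tsq_mul_algebraMap_mem_cuspLineModel (P : k[X][X]) :
    tK k ^ 2 * algebraMap k[X][X] (K₂ k) P ∈ cuspLineModel k := by
  induction P using Polynomial.induction_on' with
  | add p q hp hq =>
    rw [map_add, mul_add]
    exact Subalgebra.add_mem _ hp hq
  | monomial n a =>
    rw [← C_mul_X_pow_eq_monomial, map_mul, map_pow, ← mul_assoc, mul_comm (tK k ^ 2), mul_assoc,
      ← pow_add]
    exact Subalgebra.mul_mem _ (algebraMap_C_mem_cuspLineModel k a)
      (pow_mem_cuspLineModel k (by omega))

/-- `t ≠ 0`. [folklore] -/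
theorem tK_ne_zero : tK k ≠ 0 := by
  rw [Ne, FaithfulSMul.algebraMap_eq_zero_iff]
  exact X_ne_zero

/-- `Frac k[t², t³, y] = k(t, y)` (`z = t²a / t²b`). [folklore] -/
instance isFractionRing_cuspLineModel : IsFractionRing (cuspLineModel k) (K₂ k) := by
  refine IsFractionRing.of_field (cuspLineModel k) (K₂ k) fun z => ?_
  obtain ⟨a, b, -, rfl⟩ := IsFractionRing.div_surjective (A := k[X][X]) z
  refine ⟨⟨_, tsq_mul_algebraMap_mem_cuspLineModel k a⟩,
    ⟨_, tsq_mul_algebraMap_mem_cuspLineModel k b⟩, ?_⟩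
  change _ = (tK k ^ 2 * _) / (tK k ^ 2 * _)
  rw [mul_div_mul_left _ _ (pow_ne_zero 2 (tK_ne_zero k))]

/-- The invariant of `k[t², t³, y]`: vanishing `t¹`-coefficient (in `k[y]`). [folklore] -/
theorem exists_coeff_one_eq_zero_of_mem_cuspLineModel {x : K₂ k} (hx : x ∈ cuspLineModel k) :
    ∃ P : k[X][X], P.coeff 1 = 0 ∧ algebraMap k[X][X] (K₂ k) P = x := by
  induction hx using Algebra.adjoin_induction with
  | mem x hx =>
    rcases hx with rfl | rfl | rfl
    · exact ⟨X ^ 2, by simp [Polynomial.coeff_X_pow], by simp⟩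
    · exact ⟨X ^ 3, by simp [Polynomial.coeff_X_pow], by simp⟩
    · exact ⟨C X, by simp, rfl⟩
  | algebraMap c =>
    refine ⟨C (C c), by simp, ?_⟩
    rw [IsScalarTower.algebraMap_apply k k[X][X] (K₂ k), Polynomial.algebraMap_apply,
      Polynomial.algebraMap_eq]
  | add x y _ _ hx hy =>
    obtain ⟨p, hp, rfl⟩ := hx
    obtain ⟨q, hq, rfl⟩ := hy
    exact ⟨p + q, by simp [hp, hq], by simp⟩
  | mul x y _ _ hx hy =>
    obtain ⟨p, hp, rfl⟩ := hx
    obtain ⟨q, hq, rfl⟩ := hy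
    refine ⟨p * q, ?_, by simp⟩
    simp [Polynomial.coeff_mul, Finset.Nat.sum_antidiagonal_eq_sum_range_succ_mk,
      Finset.sum_range_succ, hp, hq]

/-- Evaluation at the point `(t, y) = (0, c)`. [folklore] -/
abbrev evPoint (c : k) : k[X][X] →+* k := eval₂RingHom (evalRingHom c) 0

/-- Evaluation at `(0, c)` reads the constant-in-`t` coefficient at `y = c`. [folklore] -/
theorem evPoint_apply (c : k) (P : k[X][X]) : evPoint k c P = (P.coeff 0).eval c := by
  simp [evPoint, eval₂_at_zero]

/-- The maximal ideal `(t, y - c)` of the chart `k[t, y]`, as the kernel of evaluation at `(0, c)`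
transported to `planeModel`. [folklore] -/
def pointIdeal (c : k) : Ideal (planeModel k) :=
  Ideal.comap ((planeModelEquiv k).symm : planeModel k →+* k[X][X]) (RingHom.ker (evPoint k c))

/-- `(t, y - c)` is prime. [folklore] -/
instance pointIdeal_isPrime (c : k) : (pointIdeal k c).IsPrime := by
  unfold pointIdeal
  haveI : (RingHom.ker (evPoint k c)).IsPrime := RingHom.ker_isPrime _
  infer_instance

/-- Membership in `(t, y - c)`: vanishing at `(0, c)`. [folklore] -/
theorem mem_pointIdeal_iff (c : k) (P : k[X][X]) (h : algebraMap k[X][X] (K₂ k) P ∈ planeModel k) :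
    (⟨_, h⟩ : planeModel k) ∈ pointIdeal k c ↔ (P.coeff 0).eval c = 0 := by
  rw [pointIdeal, Ideal.mem_comap, RingHom.mem_ker]
  change evPoint k c ((planeModelEquiv k).symm ⟨_, h⟩) = 0 ↔ _
  rw [planeModelEquiv_symm_apply, evPoint_apply]

/-- Distinct points give distinct ideals (`y - c₁ ∈ (t, y - c₁) ∖ (t, y - c₂)`). [folklore] -/
theorem pointIdeal_injective : Function.Injective (pointIdeal k) := by
  intro c₁ c₂ h
  have hP : algebraMap k[X][X] (K₂ k) (C (X - C c₁)) ∈ planeModel k :=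
    (mem_planeModel_iff k).mpr ⟨_, rfl⟩
  have hmem : (⟨_, hP⟩ : planeModel k) ∈ pointIdeal k c₁ := by
    rw [mem_pointIdeal_iff]; simp
  rw [h, mem_pointIdeal_iff] at hmem
  simpa [sub_eq_zero, eq_comm] using hmem

/-- **The cusp × line is singular along `t = 0`**: for every `c`, the local ring of
`R = k[t², t³, y]` at the contraction of `(t, y - c)` is not regular. [folklore] -/
theorem not_isRegularLocalRing_cuspLine (c : k) :
    ¬ IsRegularLocalRing (Localization.AtPrime ((pointIdeal k c).comap
      (Subalgebra.inclusion (cuspLineModel_le_planeModel k)).toRingHom)) := by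
  refine not_isRegularLocalRing_localization_of_pow_mem (R₀ := cuspLineModel k) _ (tK k) two_pos
    ⟨⟨tK k ^ 2, Algebra.subset_adjoin (by simp)⟩, rfl⟩ ?_
  intro a s hs hts
  obtain ⟨Pa, hPa1, hPa⟩ := exists_coeff_one_eq_zero_of_mem_cuspLineModel k a.2
  obtain ⟨Ps, -, hPs⟩ := exists_coeff_one_eq_zero_of_mem_cuspLineModel k s.2
  have hinj := IsFractionRing.injective k[X][X] (K₂ k)
  have hX : X * Ps = Pa := hinj (by rw [map_mul, hPs, hPa]; exact hts)
  have h0 : Ps.coeff 0 = 0 := by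
    have := congrArg (fun p : k[X][X] => p.coeff 1) hX
    simp only [Polynomial.coeff_X_mul] at this
    rw [this, hPa1]
  apply hs
  rw [Ideal.mem_comap]
  change (⟨(s : K₂ k), cuspLineModel_le_planeModel k s.2⟩ : planeModel k) ∈ pointIdeal k c
  have hs' : (⟨(s : K₂ k), cuspLineModel_le_planeModel k s.2⟩ : planeModel k) =
      ⟨_, hPs ▸ cuspLineModel_le_planeModel k s.2⟩ := Subtype.ext hPs.symm
  rw [hs', mem_pointIdeal_iff, h0, eval_zero]

/-- Over an infinite field the set of primes `𝔭` of the chart `B = k[t, y]` with `B_𝔭` regular but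
`R_{𝔭 ∩ R}` NOT regular (`R = k[t², t³, y]`; NO height condition) is infinite. [folklore] -/
theorem infinite_exceptionalPrimes_cuspLine [Infinite k] :
    {𝔭 : PrimeSpectrum (planeModel k) |
      IsRegularLocalRing (Localization.AtPrime 𝔭.asIdeal) ∧
      ¬ IsRegularLocalRing (Localization.AtPrime
        (𝔭.asIdeal.comap (Subalgebra.inclusion (cuspLineModel_le_planeModel k)).toRingHom))}.Infinite := by
  have hinj : Function.Injective fun c : k => (⟨pointIdeal k c, inferInstance⟩ : PrimeSpectrum (planeModel k)) :=
    fun c₁ c₂ h => pointIdeal_injective k (congrArg PrimeSpectrum.asIdeal h)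
  refine Set.Infinite.mono ?_ (Set.infinite_range_of_injective hinj)
  rintro _ ⟨c, rfl⟩
  refine ⟨?_, ?_⟩
  · exact IsRegularRing.isRegularLocalRing_localization (pointIdeal k c)
  · exact not_isRegularLocalRing_cuspLine k c

end CuspTimesLine

/-- **Stub 3 of line `regular-atlas` WITHOUT its height-one clause is false.**  The statement
negated is `stub_exceptionalPrimesFinite` (`Lines/regular_atlas.lean`) with `𝔭.asIdeal.height = 1`
deleted from the set, everything else verbatim; witness `k = 𝔽₂^alg`, `K = k(t, y)`,
`R = k[t², t³, y] ≤ B = k[t, y]`: the infinitely many maximal ideals `(t, y - c)`. [folklore] -/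
theorem stub_exceptionalPrimesFinite_false_without_heightOne :
    ¬ ∀ (k K : Type) [Field k] [Field K] [Algebra k K] (R B : Subalgebra k K) (hRB : R ≤ B),
      R.FG → B.FG → IsFractionRing R K →
      {𝔭 : PrimeSpectrum B | IsRegularLocalRing (Localization.AtPrime 𝔭.asIdeal) ∧
        ¬ IsRegularLocalRing (Localization.AtPrime
          (𝔭.asIdeal.comap (Subalgebra.inclusion hRB).toRingHom))}.Finite :=
  fun h => infinite_exceptionalPrimes_cuspLine (AlgebraicClosure (ZMod 2))
    (h _ (K₂ (AlgebraicClosure (ZMod 2))) (cuspLineModel _) (planeModel _)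
      (cuspLineModel_le_planeModel _) (cuspLineModel_fg _) (planeModel_fg _) inferInstance)

end Summit.ResolutionOfSingularities.ResolutionOfSingularities.Theorems.NonRuledCofinite.Negative

end
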